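import Mathlib
import Summits.NavierStokesRegularity.NavierStokesRegularity.Theorems.FilamentSkeletonRssSkeletonJ1RLiaDefectDerivSplit
import Literature.Analysis.Calculus.SmoothCutoff

/-!
# Crux `SkeletonJ1R` (stmt-NavierStokesRegularity-23610) · line `streamline_kantorovich_R` · toward stub F2-d (`LiaDefectDerivBL`, v7):
# ON THE SWITCHED REGION THE LIA REFERENCE IS `C³` ALONG ITSELF — THE DERIVATIVE OF ITS CURVATURE VECTOR, EXPLICITLY

Lead `ns-fsr-lead-23610` g2, `--supports stmt-NavierStokesRegularity-23610 --as helper`.  MODEL rung, NEGATIVE side of the ladder: calculus for a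
HYPOTHETICAL filament-type blow-up skeleton; nothing here is a claim about Navier–Stokes regularity; the stub and the crux stay OPEN.

The LIA term `β T × T′` of the residual (`…LiaDefectDerivResidual`) is differentiated along the reference through the reference ODE
`x″ = (β⁻¹ φ(x)) • x′ × W(x)` (`φ = refCutoff ℓ`, `W = ambientField`, `C^∞` by `…LiaReference.contDiff_ambientField`):
(`smoothTransition′ r = 0` for `r ≥ 1`: `Literature.Analysis.Calculus.deriv_smoothTransition_of_one_le`)
* `hasDerivAt_refCutoff_comp_of_sq_le` — along any differentiable point path, the reference cutoff has derivative `0` wherever `‖y‖² ≤ 2ℓ²` (`ℓ ≠ 0`);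
* `IsLiaReference.hasDerivAt_deriv_deriv` — on the closed switched region `‖x_j τ‖² ≤ 2ℓ²`:
  `(x_j″)′(τ) = β⁻¹ • (x_j″ τ × W(x_j τ) + x_j′ τ × (DW(x_j τ)·x_j′ τ))`.
-/

set_option linter.dupNamespace false -- `NavierStokesRegularity.NavierStokesRegularity` path/namespace repetition is the tree convention

noncomputable section

namespace Summit.NavierStokesRegularity.NavierStokesRegularity.Theorems.SkeletonJ1RFrame

open Set Function Filter MeasureTheory Real Topology
open Literature.Analysis.FluidPDE
open Summit.NavierStokesRegularity.NavierStokesRegularity.Theorems.SkeletonJ1RLiaSelf (contDiff_one_deriv)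
open scoped InnerProductSpace BigOperators

/-! ## §1 The cutoff is flat on the switched region -/

/-- **Along a differentiable point path the reference cutoff has derivative `0` wherever `‖y τ‖² ≤ 2ℓ²`** (`ℓ ≠ 0`). [folklore] -/
theorem hasDerivAt_refCutoff_comp_of_sq_le {ℓ : ℝ} (hℓ : ℓ ≠ 0) {y : ℝ → EuclideanSpace ℝ (Fin 3)} {y' : EuclideanSpace ℝ (Fin 3)} {τ : ℝ}
    (hy : HasDerivAt y y' τ) (hreg : ‖y τ‖ ^ 2 ≤ 2 * ℓ ^ 2) :
    HasDerivAt (fun τ' => refCutoff ℓ (y τ')) 0 τ := by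
  have h := hasDerivAt_switchWeight_comp (ℓ := ℓ) (s := (3/2:ℝ)) hy
  have harg : 1 ≤ 1 - (‖y τ‖ ^ 2 / ℓ ^ 2 + 1 - 2 * (3/2:ℝ)) := by
    have hℓ2 : 0 < ℓ ^ 2 := by positivity
    have : ‖y τ‖ ^ 2 / ℓ ^ 2 ≤ 2 := by rw [div_le_iff₀ hℓ2]; linarith
    linarith
  rw [Literature.Analysis.Calculus.deriv_smoothTransition_of_one_le harg, zero_mul] at h
  refine h.congr_of_eventuallyEq (Eventually.of_forall fun τ' => ?_)
  simp only [refCutoff]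

/-! ## §2 The derivative of the curvature vector of the reference on the switched region -/

variable {N : ℕ} {Γ Rb : ℝ} {p t : Fin N → EuclideanSpace ℝ (Fin 3)} {γ : Fin N → ℝ} {α : ℝ} {s₀ : Fin N → ℝ}
  {x : Fin N → ℝ → EuclideanSpace ℝ (Fin 3)}

/-- **ON THE CLOSED SWITCHED REGION THE CURVATURE VECTOR OF THE LIA REFERENCE IS DIFFERENTIABLE ALONG THE REFERENCE, EXPLICITLY**:
for `‖x_j τ‖² ≤ 2ℓ²` (`ℓ = Rb√(Γ log Γ) ≠ 0`, unit datum directions),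
`(x_j″)′(τ) = (liaCoeff)⁻¹ • (x_j″ τ × W_j(x_j τ) + x_j′ τ × (D W_j(x_j τ) · x_j′ τ))`, `W_j = ambientField`. [folklore] -/
theorem IsLiaReference.hasDerivAt_deriv_deriv (hx : IsLiaReference Γ Rb p t γ α s₀ x) (ht : ∀ k, ‖t k‖ = 1)
    (hℓ : Rb * Real.sqrt (Γ * Real.log Γ) ≠ 0) (j : Fin N) (τ : ℝ) (hreg : ‖x j τ‖ ^ 2 ≤ 2 * (Rb * Real.sqrt (Γ * Real.log Γ)) ^ 2) :
    HasDerivAt (fun τ' => deriv (deriv (x j)) τ')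
      ((liaCoeff Γ γ j)⁻¹ • (cross (deriv (deriv (x j)) τ) (ambientField Γ p t γ α s₀ j (x j τ)) +
        cross (deriv (x j) τ) (fderiv ℝ (ambientField Γ p t γ α s₀ j) (x j τ) (deriv (x j) τ)))) τ := by
  obtain ⟨hC2, hunit, -, -, hode⟩ := hx j
  set ℓ := Rb * Real.sqrt (Γ * Real.log Γ) with hℓdef
  set β := liaCoeff Γ γ j with hβ
  set W := ambientField Γ p t γ α s₀ j with hW
  -- the ODE as a function identity
  have hfun : (fun τ' => deriv (deriv (x j)) τ') = fun τ' => (β⁻¹ * refCutoff ℓ (x j τ')) • cross (deriv (x j) τ') (W (x j τ')) := by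
    funext τ'
    have h := hode τ'
    rw [iteratedDeriv_succ, iteratedDeriv_one] at h
    exact h
  rw [hfun]
  -- the pieces
  have hp : HasDerivAt (x j) (deriv (x j) τ) τ := ((hC2.differentiable (by norm_num)) τ).hasDerivAt
  have hT : HasDerivAt (fun τ' => deriv (x j) τ') (deriv (deriv (x j)) τ) τ :=
    (((contDiff_one_deriv hC2).differentiable one_ne_zero) τ).hasDerivAt
  have hWd : Differentiable ℝ W := (contDiff_ambientField Γ p t γ α s₀ ht j (n := 1)).differentiable one_ne_zero
  have hWx : HasDerivAt (fun τ' => W (x j τ')) (fderiv ℝ W (x j τ) (deriv (x j) τ)) τ :=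
    (hWd (x j τ)).hasFDerivAt.comp_hasDerivAt τ hp
  have hφ : HasDerivAt (fun τ' => refCutoff ℓ (x j τ')) 0 τ := hasDerivAt_refCutoff_comp_of_sq_le hℓ hp hreg
  have hg : HasDerivAt (fun τ' => β⁻¹ * refCutoff ℓ (x j τ')) 0 τ := by
    simpa using hφ.const_mul β⁻¹
  have hcr : HasDerivAt (fun τ' => cross (deriv (x j) τ') (W (x j τ')))
      (cross (deriv (x j) τ) (fderiv ℝ W (x j τ) (deriv (x j) τ)) + cross (deriv (deriv (x j)) τ) (W (x j τ))) τ := by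
    have h := crossCLM.hasDerivAt_of_bilinear (fun _ => hT) (fun _ => hWx)
    simpa only [crossCLM_apply] using h
  have h := hg.smul hcr
  refine h.congr_deriv ?_
  rw [refCutoff_eq_one hℓ hreg, mul_one, zero_smul, add_zero, add_comm]

end Summit.NavierStokesRegularity.NavierStokesRegularity.Theorems.SkeletonJ1RFrame

end
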